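import Literature.Analysis.FunctionSpaces.TorusVectorParseval
import Literature.Analysis.FunctionSpaces.TorusTrigPoly
import Literature.Analysis.FluidPDE.StatisticalSolutionEnergyEq
import Summits.AnomalousDissipation.AnomalousDissipation.Theorems.SolenoidalFractalHomogenisationLagrangianStepDefs
import HarnessLib

/-!
# K1L_D (stmt-AnomalousDissipation-27980), stub `stub_oneLevelL_IW`: the length-scale class is stable under Fourier truncation (F-lead-5, P1)
# (helper; `--supports … --as helper`)

`InClass R w₀` (`‖∇w₀‖² ≤ R‖w₀‖²`, `…LagrangianStepDefs`) passes to every Fourier truncation `P_N w₀` of an `L²` field: truncation keeps the modes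
of SMALLEST `|k|²`, so the Rayleigh quotient (a weighted average of `4π²|k|²`) can only go down.  Proof: Bernstein on the ball
(`‖∇P_N w‖² ≤ 4π²N²‖P_N w‖²`) against the spectral gap off the ball (`‖∇(w − P_N w)‖² ≥ 4π²N²‖w − P_N w‖²`), in `ℝ≥0∞` via Parseval.
Needed by the composition of the one-level inequality, which runs the window ledger on the TRIMMED datum `P_{L_c} w₀` (lead g2 F-lead-5,
`…LagrangianStepLedgerTrim`).  Infrastructure for rung F-D1.A0; NOT a proof of the crux or of anomalous dissipation.
-/

set_option linter.dupNamespace false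

namespace Summit.AnomalousDissipation.AnomalousDissipation.Theorems.SolenoidalFractalHomogenisation.LagrangianStep

open MeasureTheory Literature.Analysis Literature.Analysis.FluidPDE Literature.Analysis.FunctionSpaces
open Literature.Analysis.FunctionSpaces.Torus UnitAddTorus
open scoped ENNReal NNReal

/-- Abstract averaging step in `ℝ≥0∞`: if the "low" block has gradient `G ≤ c·X` and the "high" block has gradient `H ≥ c·Y`, and the total is in
class `R` (`G + H ≤ R (X + Y)` with `Y` finite), then the low block is in class `R`: `G ≤ R X`. -/
theorem low_block_inClass {G H X Y c R : ℝ≥0∞} (hY : Y ≠ ⊤) (hG : G ≤ c * X) (hH : c * Y ≤ H)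
    (h : G + H ≤ R * (X + Y)) : G ≤ R * X := by
  by_cases hcR : c ≤ R
  · exact hG.trans (by gcongr)
  · rw [not_le] at hcR
    by_contra hlt
    rw [not_le] at hlt
    have hRne : R ≠ ⊤ := ne_top_of_lt hcR
    have hRY : R * Y ≤ H := le_trans (by gcongr) hH
    have hRYne : R * Y ≠ ⊤ := ENNReal.mul_ne_top hRne hY
    have : R * X + R * Y < G + H := ENNReal.add_lt_add_of_lt_of_le hRYne hlt hRY
    rw [← mul_add] at this
    exact absurd (h.trans_lt this) (lt_irrefl _)

/-- **The class `R` is stable under Fourier truncation**: `‖∇w‖² ≤ R‖w‖² ⇒ ‖∇P_N w‖² ≤ R‖P_N w‖²` for `w ∈ L²`. -/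
theorem inClass_fourierTruncate {R : ℝ≥0} {w : VF} (hw : MemLp w 2 volume) (h : InClass R w) (N : ℕ) :
    InClass R (Torus.fourierTruncate N w) := by
  classical
  have hint : Integrable w volume := hw.integrable one_le_two
  -- notation: spectral energies
  set e : (Fin 3 → ℤ) → ℝ≥0∞ := fun k => ‖mFourierCoeff (EuclideanSpace.complexify ∘ w) k‖ₑ ^ 2 with he
  set f : (Fin 3 → ℤ) → ℝ≥0∞ := fun k => ENNReal.ofReal (freqNormSq k) with hf
  set S : Finset (Fin 3 → ℤ) := freqBall N with hS
  set C : ℝ≥0∞ := ENNReal.ofReal (4 * Real.pi ^ 2) with hC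
  -- (1) `ofReal ‖w‖² = ∑' e`
  have hL2w : ENNReal.ofReal (FluidPDE.Torus.vectorL2Sq w) = ∑' k, e k := by
    rw [FluidPDE.Torus.vectorL2Sq, FluidPDE.Torus.ofReal_integral_norm_sq_eq_lintegral hw,
      ← tsum_enorm_sq_mFourierCoeff_complexify hw]
  -- (2) `ofReal ‖P w‖² = ∑_S e`
  have hL2P : ENNReal.ofReal (FluidPDE.Torus.vectorL2Sq (fourierTruncate N w)) = ∑ k ∈ S, e k := by
    rw [FluidPDE.Torus.vectorL2Sq, integral_norm_sq_fourierTruncate hint, ENNReal.ofReal_sum_of_nonneg (fun _ _ => sq_nonneg _)]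
    refine Finset.sum_congr rfl fun k _ => ?_
    simp only [he, ENNReal.ofReal_pow (norm_nonneg _), ofReal_norm]
  -- (3) `‖∇w‖² = C ∑' f e`, `‖∇ P w‖² = C ∑_S f e`
  have hGw : eGradNormSq w = C * ∑' k, f k * e k := by
    simp only [hC, hf, he]; exact eGradNormSq_eq_tsum w
  have hGP : eGradNormSq (fourierTruncate N w) = C * ∑ k ∈ S, f k * e k := by
    rw [eGradNormSq_eq_tsum]
    simp only [hC, hf, he]
    congr 1
    rw [tsum_eq_sum (s := S) (fun k hk => by rw [mFourierCoeff_fourierTruncate hint, if_neg hk]; simp)]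
    refine Finset.sum_congr rfl fun k hk => ?_
    rw [mFourierCoeff_fourierTruncate hint, if_pos hk]
  -- (4) split the full sums over `S` and its complement
  have hsplit_e : ∑' k, e k = ∑ k ∈ S, e k + ∑' k : ↥((S : Set (Fin 3 → ℤ))ᶜ), e k :=
    (ENNReal.sum_add_tsum_compl S e).symm
  have hsplit_fe : ∑' k, f k * e k = ∑ k ∈ S, f k * e k + ∑' k : ↥((S : Set (Fin 3 → ℤ))ᶜ), f k * e k :=
    (ENNReal.sum_add_tsum_compl S (fun k => f k * e k)).symm
  -- (5) Bernstein on the ball and the spectral gap off the ball, with `c := C · N²`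
  have hlow : C * ∑ k ∈ S, f k * e k ≤ (C * ENNReal.ofReal ((N : ℝ) ^ 2)) * ∑ k ∈ S, e k := by
    calc C * ∑ k ∈ S, f k * e k ≤ C * ∑ k ∈ S, ENNReal.ofReal ((N : ℝ) ^ 2) * e k := by
          gcongr with k hk
          rw [hf]
          exact ENNReal.ofReal_le_ofReal (mem_freqBall.mp hk)
      _ = (C * ENNReal.ofReal ((N : ℝ) ^ 2)) * ∑ k ∈ S, e k := by rw [mul_assoc, ← Finset.mul_sum]
  have hhigh : (C * ENNReal.ofReal ((N : ℝ) ^ 2)) * ∑' k : ↥((S : Set (Fin 3 → ℤ))ᶜ), e k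
      ≤ C * ∑' k : ↥((S : Set (Fin 3 → ℤ))ᶜ), f k * e k := by
    rw [mul_assoc, ← ENNReal.tsum_mul_left]
    gcongr with k
    have hk : (k : Fin 3 → ℤ) ∉ freqBall N := by
      have := k.2
      rw [Set.mem_compl_iff, Finset.mem_coe] at this
      exact this
    rw [hf]
    exact ENNReal.ofReal_le_ofReal (le_of_lt (not_mem_freqBall.mp hk))
  -- (6) the hypothesis in split form
  have hX : (∑ k ∈ S, e k) ≠ ⊤ := by
    refine ENNReal.sum_ne_top.2 fun k _ => ?_
    rw [he]
    exact ENNReal.pow_ne_top enorm_ne_top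
  have hhyp : C * ∑ k ∈ S, f k * e k + C * ∑' k : ↥((S : Set (Fin 3 → ℤ))ᶜ), f k * e k
      ≤ (R : ℝ≥0∞) * (∑ k ∈ S, e k + ∑' k : ↥((S : Set (Fin 3 → ℤ))ᶜ), e k) := by
    have h' := h
    rw [InClass, hGw, hL2w, hsplit_fe, hsplit_e, mul_add] at h'
    exact h'
  -- (7) conclude
  have hY : (∑' k : ↥((S : Set (Fin 3 → ℤ))ᶜ), e k) ≠ ⊤ := by
    refine ne_top_of_le_ne_top (b := ∑' k, e k) ?_ (ENNReal.tsum_comp_le_tsum_of_injective Subtype.val_injective _)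
    rw [← hL2w]; exact ENNReal.ofReal_ne_top
  have key := low_block_inClass hY hlow hhigh hhyp
  rw [InClass, hGP, hL2P]
  exact key

end Summit.AnomalousDissipation.AnomalousDissipation.Theorems.SolenoidalFractalHomogenisation.LagrangianStep
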